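import Mathlib
import Literature.MathematicalPhysics.KineticTheory.LangevinChainGibbs
import Literature.MathematicalPhysics.KineticTheory.PhaseSpacePoisson
import Literature.MathematicalPhysics.KineticTheory.InfiniteChainDynamics
import Literature.MathematicalPhysics.KineticTheory.InfiniteChainInvariantStates
import Literature.MathematicalPhysics.KineticTheory.FluctuationSpace
import HarnessLib

/-!
# The momentum-Hermite ladder of an oscillator chain at temperature `T`

Topic `Literature/MathematicalPhysics/KineticTheory` (next to `InfiniteChainDynamics`);
definition request `defn-MomentumHermiteLadder` (route `HermiteLadder` of
`AtomisticToContinuum/FouriersLaw`, wanted by `WindowDecomposition` / the informal crux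
`DegreeMourre`; companion of the route items `LadderAdjoint` and `FloorGap`).

## The structure (Risken 1996, §10.1.3–10.1.4 and §10.4; the lattice version is the tensorisation)

For the Kramers equation of one particle Risken introduces boson operators in the velocity,
`b = v_th ∂_v + ½ v/v_th`, `b⁺ = -v_th ∂_v + ½ v/v_th`, `[b, b⁺] = 1` (10.22)–(10.23), position
operators `D = v_th ∂_x - ε f'/v_th`, `D̂ = v_th ∂_x + (1-ε) f'/v_th` with `D⁺ = -D̂` for `ε = ½`
(10.27)–(10.29), and splits the streaming (Liouville) operator as
`L̄_rev = -b D - b⁺ D̂` (10.26), `= -∑_i (b_i D_i + b_i⁺ D̂_i)` in several dimensions (10.35),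
anti-Hermitian (10.30). Expanding in the Hermite functions `ψ_n(v) ∝ He_n(v/v_th) e^{-v²/4v_th²}`
(10.40), orthonormal and complete (10.41), with `b⁺ ψ_n = √(n+1) ψ_{n+1}`, `b ψ_n = √n ψ_{n-1}`
(10.45), `W = ψ_0 ∑_n c_n(x) ψ_n(v)` (10.43), (10.50), turns the Kramers equation into the
tridiagonal Brinkman hierarchy (10.46)/(10.51) coupling `c_n` only to `c_{n±1}`; truncating at
`n = 1` and eliminating `c_1` gives the Smoluchowski (overdamped) operator `γ⁻¹ D D̂` (10.168)–(10.170).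

Here: the chain `P : OscillatorChain` at temperature `T` (`v_th = √T`, unit masses), in the
Koopman (observable) picture on `L²(μ_T)`, `μ_T` a Gibbs state whose momenta are i.i.d.
`N(0, T)` independent of the positions, with the FLAT (unnormalised) Hermite basis
`He_α(p) = ∏_x He_{α_x}(p_x/√T)` (Mathlib `Polynomial.hermite` = probabilists' `He_n`):
`L²(μ_T) = ⊕̂_n 𝒫_n`, `𝒫_n` = closed span of `G(q) He_α(p)`, `|α| = n`; on smooth functions
`L_H = ∑_x (p_x ∂_{q_x} - ∂_{q_x}H ∂_{p_x}) = R - R†` with the raising operator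
`R = ∑_x (p_x - T ∂_{p_x}) ∂_{q_x}` (`R 𝒫_n ⊆ 𝒫_{n+1}`) and its Gibbs adjoint
`R† = ∑_x (-∂_{q_x} + T⁻¹ ∂_{q_x}H) T ∂_{p_x}` (`R† 𝒫_n ⊆ 𝒫_{n-1}`); the floor `R† R|_{𝒫_0} = -S_q`,
`S_q = ∑_x (T ∂²_{q_x} - ∂_{q_x}H ∂_{q_x})`; the energy current `j_x ∈ 𝒫_1`.

## Contents

* §1 `hermiteFun T n p = He_n(p/√T)` and the one-variable ladder identities, PROVED:
  `derivative_hermite_succ` (Appell, `He_{n+1}' = (n+1) He_n`, not in Mathlib),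
  `sub_temp_mul_deriv_hermiteFun` (`(p - T∂_p) He_n^T = √T He_{n+1}^T`, `T > 0`),
  `temp_mul_deriv_hermiteFun_succ` (`T ∂_p He_{n+1}^T = (n+1) √T He_n^T`), `hermiteFun_neg`
  (parity `(-1)^n`), `hermiteFun_succ_succ` (three-term recurrence).
* §2 For any grading `V : ℕ → Submodule ℝ E` of a real Hilbert space: `degreeProjection V n`
  (`P_n`, orthogonal projection onto the closure of `V n`), `IsOrthogonalGrading V`
  (`E = ⊕̂ V̄ n`), `numberOperator V = ∑ n P_n` (a `LinearPMap` on `numberDomain`),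
  `evenSubspace/oddSubspace`, `parityOperator V = P_even - P_odd` (`Π = (-1)^𝒩`), `degreeLE`.
* §3 `MomentumHermiteLadder ι Q Ω` (position map, momentum coordinates, temperature) and, for a
  state `μ`: `hermiteMonomial`, `elementary n` (the functions `G(q) He_α`, `|α| = n`),
  `degreeSubspace μ n = 𝒫_n(μ) ⊂ Lp ℝ 2 μ` (closed; orthogonal projection available), the
  abbreviations `grading/proj/number/parity`, `toLp_mem_degreeSubspace`, `proj_toLp`, and the
  standing hypothesis `IsGibbsGaussian μ` (probability, `T > 0`, positions ⫫ momenta, momenta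
  i.i.d. `N(0,T)`; Mathlib `IndepFun/iIndepFun/gaussianReal`).
* §4 The `N`-site chain: `ofPhaseSpace N T`, `hermiteProd`, the pointwise operators
  `momentumRaising T` (`R`), `OscillatorChain.momentumLowering P N T` (`R†`, literally the
  `R†` of route item `LadderAdjoint`), `OscillatorChain.liouvillian P N` (`L_H`),
  `OscillatorChain.smoluchowski P N T` (`S_q`), with PROVED API: `liouvillian_eq_poisson`
  (`L_H = {H, ·}`), `partialP_partialQ_comm` (Schwarz), `liouvillian_eq_momentumRaising_sub_momentumLowering`
  (`L_H = R - R†` for `C²` functions: part (a) of `LadderAdjoint`),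
  `momentumLowering_momentumRaising_comp_fst` (`R† R = -S_q` on functions of `q`, unconditional),
  `elementaryFun T G α = G(q) He_α(p)`, `momentumRaising_elementaryFun`
  (`R (G He_α) = √T ∑_i ∂_iG He_{α+e_i}`), `momentumLowering_elementaryFun`
  (`R† (G He_α) = ∑_i (α_i/√T)(-T∂_iG + ∂_iΦ G) He_{α-e_i}`),
  `bondCurrent_mem_span_elementary_one` (`j_i ∈ span(elementary 1)`).
* §5 The infinite chain: `ofChainConfig T`, coordinate derivatives `partialQZ/partialPZ` on
  `ChainConfig`, `momentumRaisingZ`, `OscillatorChain.momentumLoweringZ/liouvillianZ/smoluchowskiZ`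
  (`finsum` over sites; finite sums on cylinder functions: `liouvillianZ_eq_sum`,
  `momentumRaisingZ_eq_sum`, via Mathlib `DependsOn`), `bondCurrentZ_mem_span_elementary_one`.
* §6 The same grading on the zero-wavenumber space `ℋ₀(μ)` of a `FluctuationStructure`
  (`FluctuationSpace.lean`; the chain's `ZeroWavenumberSpace` is its pending instance `G = ℤ`):
  `fluctDegreeSubspace`, `fluctGrading/fluctProj/fluctNumber/fluctParity`,
  `fluct_mem_fluctDegreeSubspace(_of_eq_add)` (so `[j_0]` has degree one).

## What is NOT here (and why)

* `L²(μ) = ⊕̂_n 𝒫_n` (orthogonality + density) for a Gibbs state is a THEOREM about Gaussian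
  measures (Hermite polynomials are an orthogonal basis of `L²(N(0,T))`; density of polynomials
  is not in Mathlib): expressed as `IsOrthogonalGrading (L.grading μ)`, not asserted; likewise
  `IsGibbsGaussian` for `OscillatorChain.gibbsMeasure` / DLR states is to be proved by users
  (it is the factorisation `e^{-H/T} = e^{-Φ(q)/T} ∏ e^{-p_x²/2T}`), not assumed anywhere here.
* `R†` is the `L²(e^{-H/T})`-adjoint of `R` (integration by parts) — route item `LadderAdjoint`
  (b); the commutator `[R†, R] = -S_q - T⁻¹ ∑ (∂_{q_x}∂_{q_y}H)(p_y - T∂_{p_y})T∂_{p_x}` and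
  essential skew-adjointness of `R - R†` on cylinder functions are left to the operator layer.
* `R`, `R†` as (closable) operators ON `L²(μ)`/`ℋ₀(μ)` need the identification of smooth
  cylinder functions with their classes (injective only for states charging open sets); they are
  given pointwise on functions, the grading is given on the Hilbert spaces.

## Design choices

* Flat Hermite basis `He_n(p/√T)` in `L²(μ_T)` rather than Risken's Hermite FUNCTIONS `ψ_n` in
  flat `L²(dv)`: the two pictures are conjugate by `ψ_0 = ` square root of the Maxwellian
  ((10.25) with `ε = ½`); in ours `R = √T ∑ a_x⁺ ∂_{q_x}` with `a⁺ He_n = He_{n+1}`,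
  `a He_n = n He_{n-1}` unnormalised, whence the `√T` and `n/√T` factors in §4.
* `S_q` is written without `T⁻¹` (`∑ (T∂² - ∂H ∂)`), so `R†R = -S_q` holds for every real `T`.
* Coordinate derivatives are the tree's `partialQ/partialP` (`FouriersLaw.lean`; line
  derivatives, `LangevinChainNESSProofs.lean`), so `momentumLowering` and `liouvillian` are
  literally the expressions in route item `LadderAdjoint`; on `ChainConfig` the analogous
  `partialQZ/partialPZ` and `finsum` (junk `0` for non-cylinder functions, documented).
* Generating functions `G(q) He_α(p)` take `G : Q → ℝ` arbitrary; only square-integrable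
  products enter `𝒫_n(μ)` (membership is by a.e.-equality of `Lp` classes), no junk.
* Multi-indices: `ι →₀ ℕ` with `Finsupp.degree` in general, plain `Fin N → ℕ` (`hermiteProd`,
  `hermiteMonomial_ofPhaseSpace`) for the finite-chain calculus.
-/

noncomputable section

open MeasureTheory ProbabilityTheory Polynomial Filter Set Function
open scoped InnerProductSpace ENNReal NNReal Topology

namespace Literature.MathematicalPhysics.KineticTheory.HeatConduction

/-! ## §1. Probabilists' Hermite polynomials at the thermal scale `√T` -/

/-- **Appell property** of the probabilists' Hermite polynomials `He_n` (Mathlib's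
`Polynomial.hermite`): `He_{n+1}' = (n+1) He_n`. Together with the defining recursion
`He_{n+1} = X He_n - He_n'` (`Polynomial.hermite_succ`) this is the pair of ladder relations
`b ψ_n = √n ψ_{n-1}`, `b⁺ ψ_n = √(n+1) ψ_{n+1}` of Risken (10.45) in the unnormalised
polynomial basis. [cite: Risken1996, §10.1.4 eq. (10.45)] -/
theorem derivative_hermite_succ (n : ℕ) :
    derivative (hermite (n + 1)) = ((n : Polynomial ℤ) + 1) * hermite n := by
  induction n using Nat.twoStepInduction with
  | zero => simp
  | one =>
    rw [hermite_succ, hermite_one, derivative_sub, derivative_mul, derivative_X]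
    simp only [one_mul, mul_one, derivative_one, sub_zero, Nat.cast_one]
    ring
  | more n h0 h1 =>
    have h1' : derivative (hermite (n + 2)) = (((n + 1 : ℕ) : Polynomial ℤ) + 1) * hermite (n + 1) :=
      h1
    have hc : hermite (n + 2) = X * hermite (n + 1) - derivative (hermite (n + 1)) :=
      hermite_succ (n + 1)
    rw [hermite_succ (n + 2), derivative_sub, derivative_mul, derivative_X, h1', derivative_mul,
      h0]
    simp only [derivative_add, derivative_natCast, derivative_one, add_zero, zero_mul, zero_add,
      one_mul]
    rw [hc, h0]
    push_cast
    ring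

/-- The **thermal Hermite function** of degree `n` at temperature `T`:
`He_n^T(p) = He_n(p / √T)`, the probabilists' Hermite polynomial evaluated at the momentum in
units of the thermal velocity `v_th = √T` (unit mass, `k_B = 1`); these are the polynomial
parts of Risken's velocity eigenfunctions `ψ_n(v) ∝ He_n(v/v_th) e^{-v²/4v_th²}` (10.40), i.e.
the orthogonal polynomials of the Maxwellian `N(0, T)`. For `T ≤ 0`, `√T = 0` and the value
is the junk constant `He_n(0)`. [cite: Risken1996, §10.1.4 eq. (10.40)] -/
def hermiteFun (T : ℝ) (n : ℕ) (p : ℝ) : ℝ :=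
  aeval (p / Real.sqrt T) (hermite n)

/-- `He_0^T = 1`. [folklore] -/
@[simp] theorem hermiteFun_zero (T p : ℝ) : hermiteFun T 0 p = 1 := by
  simp [hermiteFun]

/-- `He_1^T(p) = p / √T`. [folklore] -/
@[simp] theorem hermiteFun_one (T p : ℝ) : hermiteFun T 1 p = p / Real.sqrt T := by
  simp [hermiteFun]

/-- The three-term recursion at the thermal scale:
`He_{n+1}^T(p) = (p/√T) He_n^T(p) - (He_n)'(p/√T)`. [folklore] -/
theorem hermiteFun_succ (T : ℝ) (n : ℕ) (p : ℝ) :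
    hermiteFun T (n + 1) p =
      p / Real.sqrt T * hermiteFun T n p - aeval (p / Real.sqrt T) (derivative (hermite n)) := by
  simp [hermiteFun, hermite_succ]

/-- Derivative of the thermal Hermite functions (chain rule + Appell):
`d/dp He_{n+1}^T(p) = (n+1)/√T · He_n^T(p)`. [cite: Risken1996, §10.1.4 eq. (10.45)] -/
theorem hasDerivAt_hermiteFun_succ (T : ℝ) (n : ℕ) (p : ℝ) :
    HasDerivAt (hermiteFun T (n + 1)) ((Real.sqrt T)⁻¹ * ((n + 1) * hermiteFun T n p)) p := by
  have h := (hermite (n + 1)).hasDerivAt_aeval (p / Real.sqrt T)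
  have hlin : HasDerivAt (fun q : ℝ => q / Real.sqrt T) (Real.sqrt T)⁻¹ p := by
    simpa [div_eq_mul_inv] using (hasDerivAt_id p).mul_const (Real.sqrt T)⁻¹
  have hc := h.comp p hlin
  have hc' : HasDerivAt (hermiteFun T (n + 1))
      (aeval (p / Real.sqrt T) (derivative (hermite (n + 1))) * (Real.sqrt T)⁻¹) p := hc
  clear hc
  have hc := hc'
  rw [derivative_hermite_succ] at hc
  convert hc using 1
  simp only [hermiteFun, map_mul, map_add, map_natCast, map_one]
  ring

/-- `d/dp He_0^T = 0`. [folklore] -/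
theorem hasDerivAt_hermiteFun_zero (T p : ℝ) : HasDerivAt (hermiteFun T 0) 0 p := by
  have : hermiteFun T 0 = fun _ => (1 : ℝ) := funext fun q => hermiteFun_zero T q
  rw [this]
  exact hasDerivAt_const p 1

/-- `deriv He_{n+1}^T = (n+1)/√T · He_n^T`. [folklore] -/
theorem deriv_hermiteFun_succ (T : ℝ) (n : ℕ) (p : ℝ) :
    deriv (hermiteFun T (n + 1)) p = (Real.sqrt T)⁻¹ * ((n + 1) * hermiteFun T n p) :=
  (hasDerivAt_hermiteFun_succ T n p).deriv

/-- `deriv He_0^T = 0`. [folklore] -/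
@[simp] theorem deriv_hermiteFun_zero (T p : ℝ) : deriv (hermiteFun T 0) p = 0 :=
  (hasDerivAt_hermiteFun_zero T p).deriv

/-- The thermal Hermite functions are differentiable. [folklore] -/
theorem differentiable_hermiteFun (T : ℝ) (n : ℕ) : Differentiable ℝ (hermiteFun T n) := by
  cases n with
  | zero => exact fun p => (hasDerivAt_hermiteFun_zero T p).differentiableAt
  | succ n => exact fun p => (hasDerivAt_hermiteFun_succ T n p).differentiableAt

/-- **Lowering identity** `T ∂_p He_n^T = n √T He_{n-1}^T` (here for `n + 1`): the momentum
derivative lowers the Hermite degree by one (Risken (10.45), `b ψ_n = √n ψ_{n-1}` with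
`b = v_th ∂_v + ½ v/v_th` conjugated to the flat polynomial basis). Valid for every real `T`
(both sides vanish in the same way for `T ≤ 0`). [cite: Risken1996, §10.1.4 eq. (10.45)] -/
theorem temp_mul_deriv_hermiteFun_succ (T : ℝ) (n : ℕ) (p : ℝ) :
    T * deriv (hermiteFun T (n + 1)) p = (n + 1) * Real.sqrt T * hermiteFun T n p := by
  rw [deriv_hermiteFun_succ]
  have key : T * (Real.sqrt T)⁻¹ = Real.sqrt T := by
    rw [← div_eq_mul_inv, Real.div_sqrt]
  calc T * ((Real.sqrt T)⁻¹ * ((n + 1) * hermiteFun T n p))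
      = T * (Real.sqrt T)⁻¹ * ((n + 1) * hermiteFun T n p) := by ring
    _ = Real.sqrt T * ((n + 1) * hermiteFun T n p) := by rw [key]
    _ = (n + 1) * Real.sqrt T * hermiteFun T n p := by ring

/-- **Raising identity** `(p - T ∂_p) He_n^T = √T He_{n+1}^T`: multiplication by the momentum
minus `T` times the momentum derivative raises the Hermite degree by one (Risken (10.45),
`b⁺ ψ_n = √(n+1) ψ_{n+1}`, in the flat polynomial basis; from `hermite_succ` and the Appell
property). [cite: Risken1996, §10.1.4 eq. (10.45)] -/
theorem sub_temp_mul_deriv_hermiteFun {T : ℝ} (hT : 0 < T) (n : ℕ) (p : ℝ) :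
    p * hermiteFun T n p - T * deriv (hermiteFun T n) p = Real.sqrt T * hermiteFun T (n + 1) p := by
  have hs : Real.sqrt T ≠ 0 := Real.sqrt_ne_zero'.mpr hT
  have key : T * (Real.sqrt T)⁻¹ = Real.sqrt T := by
    rw [← div_eq_mul_inv, Real.div_sqrt]
  have key2 : Real.sqrt T * (p / Real.sqrt T) = p := by
    field_simp
  cases n with
  | zero =>
    simp only [hermiteFun_zero, mul_one, deriv_hermiteFun_zero, mul_zero, sub_zero, zero_add,
      hermiteFun_one]
    exact key2.symm
  | succ n =>
    rw [hermiteFun_succ T (n + 1) p, derivative_hermite_succ, deriv_hermiteFun_succ]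
    simp only [map_mul, map_add, map_natCast, map_one]
    rw [show (aeval (p / Real.sqrt T)) (hermite n) = hermiteFun T n p from rfl]
    calc p * hermiteFun T (n + 1) p - T * ((Real.sqrt T)⁻¹ * ((n + 1) * hermiteFun T n p))
        = p * hermiteFun T (n + 1) p - T * (Real.sqrt T)⁻¹ * ((n + 1) * hermiteFun T n p) := by
          ring
      _ = Real.sqrt T * (p / Real.sqrt T) * hermiteFun T (n + 1) p -
            Real.sqrt T * ((n + 1) * hermiteFun T n p) := by rw [key, key2]
      _ = Real.sqrt T * (p / Real.sqrt T * hermiteFun T (n + 1) p -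
            (n + 1) * hermiteFun T n p) := by ring


/-- Three-term recurrence of the probabilists' Hermite polynomials:
`He_{n+2} = X He_{n+1} - (n+1) He_n`. [folklore] -/
theorem hermite_succ_succ (n : ℕ) :
    hermite (n + 2) = X * hermite (n + 1) - ((n : Polynomial ℤ) + 1) * hermite n := by
  rw [hermite_succ (n + 1), derivative_hermite_succ]

/-- Three-term recurrence at the thermal scale:
`He_{n+2}^T(p) = (p/√T) He_{n+1}^T(p) - (n+1) He_n^T(p)`. [folklore] -/
theorem hermiteFun_succ_succ (T : ℝ) (n : ℕ) (p : ℝ) :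
    hermiteFun T (n + 2) p = p / Real.sqrt T * hermiteFun T (n + 1) p - (n + 1) * hermiteFun T n p := by
  simp only [hermiteFun, hermite_succ_succ, map_sub, map_mul, aeval_X, map_add, map_natCast, map_one]

/-- **Parity** `He_n^T(-p) = (-1)^n He_n^T(p)`: momentum reversal acts as `(-1)^n` on Hermite
degree `n` (the symmetry `v → -v` of Risken §10.1.2 (10.18) in the Hermite basis). [folklore] -/
theorem hermiteFun_neg (T : ℝ) (n : ℕ) (p : ℝ) :
    hermiteFun T n (-p) = (-1) ^ n * hermiteFun T n p := by
  induction n using Nat.twoStepInduction with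
  | zero => simp
  | one => simp [neg_div]
  | more n h0 h1 =>
    rw [hermiteFun_succ_succ, hermiteFun_succ_succ, h0, h1]
    ring

/-! ## §2. Graded Hilbert spaces: degree projections, number operator, parity

The operator-theoretic part of the ladder is the same for `L²(μ)` and for Doyon's
zero-wavenumber space `ℋ₀(μ)` (definition request `ZeroWavenumberSpace`): a family
`V : ℕ → Submodule ℝ E` of "degree-`n`" subspaces of a real Hilbert space. -/

section Graded

variable {E : Type*} [NormedAddCommGroup E] [InnerProductSpace ℝ E] [CompleteSpace E]
variable (V : ℕ → Submodule ℝ E)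

/-- The **degree-`n` projection** `P_n`: orthogonal projection onto the closure of `V n`
(as a bounded operator on `E`). [folklore] -/
def degreeProjection (n : ℕ) : E →L[ℝ] E :=
  (V n).topologicalClosure.starProjection

/-- `P_n u` lies in the closed degree-`n` subspace. [folklore] -/
theorem degreeProjection_apply_mem (n : ℕ) (u : E) :
    degreeProjection V n u ∈ (V n).topologicalClosure :=
  (V n).topologicalClosure.starProjection_apply_mem u

/-- `P_n` is the identity on `V n`. [folklore] -/
theorem degreeProjection_eq_self {n : ℕ} {u : E} (hu : u ∈ V n) : degreeProjection V n u = u :=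
  Submodule.starProjection_eq_self_iff.mpr ((V n).le_topologicalClosure hu)

omit [CompleteSpace E] in
/-- **Orthogonal grading**: the degree subspaces are pairwise orthogonal and together span a
dense subspace, `E = ⊕̂_n V̄ n` (for the momentum-Hermite grading of a Gibbs state this is the
Wiener-chaos decomposition of the Gaussian momentum marginal; Risken (10.41) and the
completeness (ii) of the Hermite functions, §10.1.4). [cite: Risken1996, §10.1.4 eq. (10.41)] -/
def IsOrthogonalGrading (W : ℕ → Submodule ℝ E) : Prop :=
  (Pairwise fun m n => (W m).IsOrtho (W n)) ∧ (⨆ n, W n).topologicalClosure = ⊤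

omit [CompleteSpace E] in
/-- Under an orthogonal grading, distinct degree subspaces are orthogonal. [folklore] -/
theorem IsOrthogonalGrading.isOrtho {W : ℕ → Submodule ℝ E} (h : IsOrthogonalGrading W) {m n : ℕ}
    (hmn : m ≠ n) : (W m).IsOrtho (W n) :=
  h.1 hmn

omit [CompleteSpace E] in
/-- Under an orthogonal grading, the degree subspaces span a dense subspace. [folklore] -/
theorem IsOrthogonalGrading.topologicalClosure_iSup_eq_top {W : ℕ → Submodule ℝ E}
    (h : IsOrthogonalGrading W) : (⨆ n, W n).topologicalClosure = ⊤ :=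
  h.2

/-- The domain of the number operator: vectors `u` for which `∑_n n P_n u` converges in `E`.
[folklore] -/
def numberDomain : Submodule ℝ E where
  carrier := {u | Summable fun n : ℕ => (n : ℝ) • degreeProjection V n u}
  add_mem' := by
    intro u v hu hv
    simpa only [Set.mem_setOf_eq, map_add, smul_add] using hu.add hv
  zero_mem' := by simp [summable_zero]
  smul_mem' := by
    intro c u hu
    simpa only [Set.mem_setOf_eq, map_smul, smul_comm (c : ℝ)] using hu.const_smul c

/-- Membership in the number domain, unfolded. [folklore] -/
theorem mem_numberDomain {u : E} :
    u ∈ numberDomain V ↔ Summable fun n : ℕ => (n : ℝ) • degreeProjection V n u :=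
  Iff.rfl

/-- The **number operator** `𝒩 = ∑_n n P_n` (the "degree" variable of the ladder; Risken's
`b⁺b ψ_n = n ψ_n`, (10.37), tensorised), as a partially defined linear operator on its natural
domain. [cite: Risken1996, §10.1.4 eq. (10.37)] -/
def numberOperator : E →ₗ.[ℝ] E where
  domain := numberDomain V
  toFun :=
    { toFun := fun u => ∑' n : ℕ, (n : ℝ) • degreeProjection V n (u : E)
      map_add' := by
        intro u v
        have hu := (mem_numberDomain V).mp u.2
        have hv := (mem_numberDomain V).mp v.2
        simpa only [Submodule.coe_add, map_add, smul_add] using hu.tsum_add hv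
      map_smul' := by
        intro c u
        have hu := (mem_numberDomain V).mp u.2
        simp only [Submodule.coe_smul, map_smul, RingHom.id_apply]
        rw [show (fun n : ℕ => (n : ℝ) • c • degreeProjection V n (u : E)) =
            fun n : ℕ => c • ((n : ℝ) • degreeProjection V n (u : E)) from
          funext fun n => smul_comm _ _ _]
        exact hu.tsum_const_smul c }

/-- The number operator on its domain: `𝒩 u = ∑' n, n • P_n u`. [folklore] -/
theorem numberOperator_apply (u : numberDomain V) :
    numberOperator V u = ∑' n : ℕ, (n : ℝ) • degreeProjection V n (u : E) :=
  rfl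

omit [CompleteSpace E] in
/-- The closed **even sector** `⊕̂_k V̄ (2k)`. [folklore] -/
abbrev evenSubspace : Submodule ℝ E :=
  (⨆ k : ℕ, V (2 * k)).topologicalClosure

omit [CompleteSpace E] in
/-- The closed **odd sector** `⊕̂_k V̄ (2k+1)` (the sector containing the energy current).
[folklore] -/
abbrev oddSubspace : Submodule ℝ E :=
  (⨆ k : ℕ, V (2 * k + 1)).topologicalClosure

/-- The **parity (momentum-reversal) operator** `Π = (-1)^𝒩 := P_even - P_odd`; for the
momentum-Hermite grading of a Gibbs state this is the Koopman operator of `p ↦ -p`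
(`hermiteFun_neg`). [cite: Risken1996, §10.1.2 eq. (10.18)] -/
def parityOperator : E →L[ℝ] E :=
  (evenSubspace V).starProjection - (oddSubspace V).starProjection

omit [CompleteSpace E] in
/-- `V (2k)` lies in the even sector. [folklore] -/
theorem le_evenSubspace (k : ℕ) : V (2 * k) ≤ evenSubspace V :=
  (le_iSup (fun k : ℕ => V (2 * k)) k).trans (Submodule.le_topologicalClosure _)

omit [CompleteSpace E] in
/-- `V (2k+1)` lies in the odd sector. [folklore] -/
theorem le_oddSubspace (k : ℕ) : V (2 * k + 1) ≤ oddSubspace V :=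
  (le_iSup (fun k : ℕ => V (2 * k + 1)) k).trans (Submodule.le_topologicalClosure _)

omit [CompleteSpace E] in
/-- The vectors of **degree at most `n`**, `⊕_{k ≤ n} V k` (finite ladder truncations, as in
Risken's truncated hierarchies (10.169)). [cite: Risken1996, §10.4 eq. (10.169)] -/
def degreeLE (n : ℕ) : Submodule ℝ E :=
  ⨆ k : Fin (n + 1), V k

omit [CompleteSpace E] in
/-- `V k ≤ degreeLE V n` for `k ≤ n`. [folklore] -/
theorem le_degreeLE {k n : ℕ} (h : k ≤ n) : V k ≤ degreeLE V n :=
  le_iSup (fun j : Fin (n + 1) => V j) ⟨k, Nat.lt_succ_of_le h⟩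

end Graded

/-! ## §3. The momentum-Hermite grading of `L²(μ)` -/

/-- A **momentum-Hermite ladder structure** on a phase space `Ω` over the site set `ι`: the
position map `pos : Ω → Q`, the momentum coordinates `mom x : Ω → ℝ` (`x ∈ ι`), both
measurable, and the temperature `T` fixing the Gaussian scale `√T` of the Hermite functions
`He_n(p_x/√T)`. Instances: the `N`-site chain (`ofPhaseSpace`, `Ω = PhaseSpace N`,
`Q = Fin N → ℝ`, `ι = Fin N`) and the infinite chain (`ofChainConfig`, `Ω = ChainConfig`,
`Q = ℤ → ℝ`, `ι = ℤ`). All graded objects below (`hermiteMonomial`, `elementary`,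
`degreeSubspace`, projections, number and parity operators) are built from these data and a
state `μ`; that `μ` has Maxwellian momenta independent of the positions is the separate
predicate `IsGibbsGaussian`. This is the lattice tensorisation of Risken's one-particle
construction (§10.1.3–10.1.4: boson operators `b, b⁺` in the velocity, Hermite functions
`ψ_n(v)`, expansion coefficients `c_n(x)` depending on the position). [cite: Risken1996, §10.1.3 eqs. (10.31)–(10.36) and §10.1.4 eq. (10.43)] -/
structure MomentumHermiteLadder (ι Q Ω : Type*) [MeasurableSpace Q] [MeasurableSpace Ω] where
  /-- the position field `ω ↦ q` -/
  pos : Ω → Q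
  /-- the momentum coordinates `ω ↦ p_x` -/
  mom : ι → Ω → ℝ
  /-- the temperature (variance of each momentum in the Gibbs state) -/
  T : ℝ
  /-- the position map is measurable -/
  measurable_pos : Measurable pos
  /-- each momentum coordinate is measurable -/
  measurable_mom : ∀ x, Measurable (mom x)

namespace MomentumHermiteLadder

variable {ι Q Ω : Type*} [MeasurableSpace Q] [MeasurableSpace Ω]
variable (L : MomentumHermiteLadder ι Q Ω)

/-- The **Hermite monomial** of multi-index `α : ι →₀ ℕ`:
`He_α(ω) = ∏_{x ∈ supp α} He_{α x}(p_x(ω)/√T)`, of momentum degree `|α| = ∑_x α x`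
(Risken's `ψ_{n_1}(v_1) ψ_{n_2}(v_2) ψ_{n_3}(v_3)`, §10.1.4, in the flat polynomial basis and
for arbitrarily many momenta). [cite: Risken1996, §10.1.4 eq. (10.50)] -/
def hermiteMonomial (α : ι →₀ ℕ) (ω : Ω) : ℝ :=
  α.prod fun x k => hermiteFun L.T k (L.mom x ω)

/-- `He_0 = 1`. [folklore] -/
@[simp] theorem hermiteMonomial_zero (ω : Ω) : L.hermiteMonomial 0 ω = 1 := by
  simp [hermiteMonomial]

/-- `He_{e_x}(ω) = p_x(ω)/√T`: the momentum `p_x` itself is `√T` times a degree-one Hermite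
monomial. [folklore] -/
@[simp] theorem hermiteMonomial_single_one (x : ι) (ω : Ω) :
    L.hermiteMonomial (Finsupp.single x 1) ω = L.mom x ω / Real.sqrt L.T := by
  simp [hermiteMonomial]

/-- The Hermite monomials are measurable. [folklore] -/
theorem measurable_hermiteMonomial (α : ι →₀ ℕ) : Measurable (L.hermiteMonomial α) := by
  unfold hermiteMonomial Finsupp.prod
  refine Finset.measurable_prod _ fun x _ => ?_
  exact (differentiable_hermiteFun L.T (α x)).continuous.measurable.comp (L.measurable_mom x)

/-- The **elementary functions of momentum-Hermite degree `n`**: `ω ↦ G(q(ω)) · He_α(ω)` with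
`G : Q → ℝ` any function of the positions and `|α| = n` (Risken's expansion (10.43),
`W = ψ_0(v) ∑_n c_n(x) ψ_n(v)`, term by term; lattice version). [cite: Risken1996, §10.1.4 eq. (10.43)] -/
def elementary (n : ℕ) : Set (Ω → ℝ) :=
  {f | ∃ (G : Q → ℝ) (α : ι →₀ ℕ), α.degree = n ∧ f = fun ω => G (L.pos ω) * L.hermiteMonomial α ω}

/-- `G(q) · He_α ∈ elementary |α|`. [folklore] -/
theorem mul_hermiteMonomial_mem_elementary (G : Q → ℝ) (α : ι →₀ ℕ) :
    (fun ω => G (L.pos ω) * L.hermiteMonomial α ω) ∈ L.elementary (α.degree) :=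
  ⟨G, α, rfl, rfl⟩

/-- Functions of the positions alone are elementary of degree `0`. [folklore] -/
theorem comp_pos_mem_elementary_zero (G : Q → ℝ) : (fun ω => G (L.pos ω)) ∈ L.elementary 0 :=
  ⟨G, 0, by simp, by simp⟩

/-- `G(q) · p_x/√T` is elementary of degree `1`. [folklore] -/
theorem mul_mom_div_mem_elementary_one (G : Q → ℝ) (x : ι) :
    (fun ω => G (L.pos ω) * (L.mom x ω / Real.sqrt L.T)) ∈ L.elementary 1 :=
  ⟨G, Finsupp.single x 1, by simp, by simp⟩

/-- The **degree-`n` momentum-Hermite subspace** `𝒫_n(μ) ⊂ L²(μ)`: the closed linear span of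
the (classes of the square-integrable) elementary functions `G(q) He_α(p)`, `|α| = n`. For a
Gibbs state (`IsGibbsGaussian`) these are the Wiener-chaos spaces of the Maxwellian momenta with
position-dependent coefficients, `L²(μ) = ⊕̂_n 𝒫_n` (Risken §10.1.4 (10.41), (10.43):
orthonormality and completeness of the `ψ_n(v)`). [cite: Risken1996, §10.1.4 eqs. (10.41)–(10.43)] -/
def degreeSubspace (μ : Measure Ω) (n : ℕ) : Submodule ℝ (Lp ℝ 2 μ) :=
  (Submodule.span ℝ {u : Lp ℝ 2 μ | ∃ f ∈ L.elementary n, (u : Ω → ℝ) =ᵐ[μ] f}).topologicalClosure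

/-- `𝒫_n(μ)` is closed. [folklore] -/
theorem isClosed_degreeSubspace (μ : Measure Ω) (n : ℕ) :
    IsClosed (L.degreeSubspace μ n : Set (Lp ℝ 2 μ)) :=
  Submodule.isClosed_topologicalClosure _

/-- `𝒫_n(μ)` is complete, hence has an orthogonal projection. [folklore] -/
instance instCompleteSpaceDegreeSubspace (μ : Measure Ω) (n : ℕ) :
    CompleteSpace (L.degreeSubspace μ n) :=
  (L.isClosed_degreeSubspace μ n).completeSpace_coe

/-- The class of a square-integrable elementary function of degree `n` lies in `𝒫_n(μ)`. [folklore] -/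
theorem toLp_mem_degreeSubspace {μ : Measure Ω} {n : ℕ} {f : Ω → ℝ} (hf : f ∈ L.elementary n)
    (hf2 : MemLp f 2 μ) : hf2.toLp f ∈ L.degreeSubspace μ n :=
  (Submodule.span ℝ _).le_topologicalClosure
    (Submodule.subset_span ⟨f, hf, MemLp.coeFn_toLp hf2⟩)

/-- The family `n ↦ 𝒫_n(μ)` as a grading of the Hilbert space `L²(μ)`; feed it to
`degreeProjection`, `numberOperator`, `parityOperator`, `IsOrthogonalGrading`. [folklore] -/
abbrev grading (μ : Measure Ω) : ℕ → Submodule ℝ (Lp ℝ 2 μ) := L.degreeSubspace μ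

/-- The **degree projections** `P_n` of `L²(μ)`. [folklore] -/
abbrev proj (μ : Measure Ω) (n : ℕ) : Lp ℝ 2 μ →L[ℝ] Lp ℝ 2 μ := degreeProjection (L.grading μ) n

/-- The **number operator** `𝒩 = ∑ n P_n` of `L²(μ)`. [folklore] -/
abbrev number (μ : Measure Ω) : Lp ℝ 2 μ →ₗ.[ℝ] Lp ℝ 2 μ := numberOperator (L.grading μ)

/-- The **momentum-reversal (parity) operator** `Π = (-1)^𝒩` of `L²(μ)`. [folklore] -/
abbrev parity (μ : Measure Ω) : Lp ℝ 2 μ →L[ℝ] Lp ℝ 2 μ := parityOperator (L.grading μ)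

/-- `P_n` fixes the classes of square-integrable elementary functions of degree `n`. [folklore] -/
theorem proj_toLp {μ : Measure Ω} {n : ℕ} {f : Ω → ℝ} (hf : f ∈ L.elementary n)
    (hf2 : MemLp f 2 μ) : L.proj μ n (hf2.toLp f) = hf2.toLp f := by
  have hmem := L.toLp_mem_degreeSubspace hf hf2
  unfold proj degreeProjection
  rw [Submodule.starProjection_eq_self_iff]
  exact (Submodule.le_topologicalClosure _) hmem

/-- **The standing hypothesis on the state** (all of Risken §10.1.3–10.1.4 rests on the
Maxwellian `exp(-v²/2v_th²)` being the stationary velocity distribution, (10.21)): `μ` is a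
probability measure under which the momenta `(p_x)_x` are independent `N(0, T)` variables,
independent of the positions — true for the canonical state `Z⁻¹e^{-H/T} dq dp` of the
`N`-site chain and for every DLR Gibbs state of the infinite chain, since
`H = ∑_x p_x²/2 + Φ(q)`. Under it the spaces `𝒫_n(μ)` are the orthogonal Wiener-chaos
decomposition of `L²(μ)`. [cite: Risken1996, §10.1.3 eq. (10.21)] -/
structure IsGibbsGaussian (μ : Measure Ω) : Prop where
  /-- the state is a probability measure -/
  isProbabilityMeasure : IsProbabilityMeasure μ
  /-- the temperature is positive -/
  T_pos : 0 < L.T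
  /-- the position field is independent of the momentum field -/
  indepFun_pos_mom : IndepFun L.pos (fun ω x => L.mom x ω) μ
  /-- the momenta are mutually independent -/
  iIndepFun_mom : iIndepFun (fun x ω => L.mom x ω) μ
  /-- each momentum is centred Gaussian of variance `T` -/
  map_mom : ∀ x, μ.map (L.mom x) = gaussianReal 0 L.T.toNNReal

end MomentumHermiteLadder

/-! ## §4. The `N`-site chain: canonical coordinates, `R`, `R†`, `L_H = R - R†`, the floor -/

section FiniteChain

variable {N : ℕ}

/-- The momentum-Hermite ladder structure of the `N`-site chain at temperature `T`:
positions `x.1`, momenta `x.2 i`. [folklore] -/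
def MomentumHermiteLadder.ofPhaseSpace (N : ℕ) (T : ℝ) :
    MomentumHermiteLadder (Fin N) (Fin N → ℝ) (PhaseSpace N) where
  pos := Prod.fst
  mom i x := x.2 i
  T := T
  measurable_pos := measurable_fst
  measurable_mom i := (measurable_pi_apply i).comp measurable_snd

/-- The product Hermite function `He_α(p) = ∏_i He_{α i}(p_i/√T)` of a multi-index
`α : Fin N → ℕ` (all sites; `He_0 = 1` on the sites with `α i = 0`). [cite: Risken1996, §10.1.4 eq. (10.50)] -/
def hermiteProd (T : ℝ) (α : Fin N → ℕ) (p : Fin N → ℝ) : ℝ :=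
  ∏ i, hermiteFun T (α i) (p i)

/-- The Hermite monomial of the `N`-site ladder is the product Hermite function. [folklore] -/
theorem MomentumHermiteLadder.hermiteMonomial_ofPhaseSpace (T : ℝ) (α : Fin N →₀ ℕ)
    (x : PhaseSpace N) :
    (MomentumHermiteLadder.ofPhaseSpace N T).hermiteMonomial α x = hermiteProd T α x.2 := by
  unfold MomentumHermiteLadder.hermiteMonomial hermiteProd
  rw [Finsupp.prod_fintype]
  · rfl
  · intro i; simp

/-- Splitting off the site `i` from a product Hermite function. [folklore] -/
theorem hermiteProd_eq_mul_prod_erase (T : ℝ) (α : Fin N → ℕ) (p : Fin N → ℝ) (i : Fin N) :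
    hermiteProd T α p =
      hermiteFun T (α i) (p i) * ∏ j ∈ Finset.univ.erase i, hermiteFun T (α j) (p j) :=
  (Finset.mul_prod_erase Finset.univ (fun j => hermiteFun T (α j) (p j)) (Finset.mem_univ i)).symm

/-- A product Hermite function along the momentum line `p_i = t`. [folklore] -/
theorem hermiteProd_update_mom (T : ℝ) (α : Fin N → ℕ) (p : Fin N → ℝ) (i : Fin N) (t : ℝ) :
    hermiteProd T α (Function.update p i t) =
      hermiteFun T (α i) t * ∏ j ∈ Finset.univ.erase i, hermiteFun T (α j) (p j) := by
  rw [hermiteProd_eq_mul_prod_erase T α _ i, Function.update_self]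
  congr 1
  exact Finset.prod_congr rfl fun j hj => by
    rw [Function.update_of_ne (Finset.ne_of_mem_erase hj)]

/-- A product Hermite function with the index at site `i` changed. [folklore] -/
theorem hermiteProd_update_index (T : ℝ) (α : Fin N → ℕ) (p : Fin N → ℝ) (i : Fin N) (k : ℕ) :
    hermiteProd T (Function.update α i k) p =
      hermiteFun T k (p i) * ∏ j ∈ Finset.univ.erase i, hermiteFun T (α j) (p j) := by
  rw [hermiteProd_eq_mul_prod_erase T _ p i, Function.update_self]
  congr 1
  exact Finset.prod_congr rfl fun j hj => by
    rw [Function.update_of_ne (Finset.ne_of_mem_erase hj)]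

/-- The **raising operator** `R f = ∑_i (p_i ∂_{q_i} f - T ∂_{p_i} ∂_{q_i} f) = ∑_i (p_i - T ∂_{p_i}) ∂_{q_i} f`
on functions of the `N`-site phase space (coordinate derivatives `partialQ`, `partialP`; no
dependence on the chain): it raises the momentum-Hermite degree by one
(`momentumRaising_elementaryFun`). This is the term `-∑_i b_i⁺ D̂_i`-type half of Risken's
splitting (10.35) of the streaming operator, written in the Koopman (observable) picture on
`L²(e^{-H/T})` with the flat Hermite basis. [cite: Risken1996, §10.1.3 eqs. (10.26)–(10.27) and (10.35)] -/
def momentumRaising (T : ℝ) (f : PhaseSpace N → ℝ) (x : PhaseSpace N) : ℝ :=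
  ∑ i : Fin N, (x.2 i * partialQ i f x - T * partialP i (partialQ i f) x)

namespace OscillatorChain

variable (P : OscillatorChain)

/-- The **lowering operator** `R† g = ∑_i (-T ∂_{q_i} ∂_{p_i} g + ∂_{q_i} H ∂_{p_i} g) = ∑_i (-∂_{q_i} + T⁻¹ ∂_{q_i} H) T ∂_{p_i} g`,
the formal adjoint of `R` in `L²(e^{-H/T} dq dp)` (route item `LadderAdjoint` is the
integration-by-parts statement); it lowers the momentum-Hermite degree by one
(`momentumLowering_elementaryFun`). Risken: `D⁺ = -D̂` for `ε = ½`, (10.29)–(10.30). [cite: Risken1996, §10.1.3 eqs. (10.27)–(10.30)] -/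
def momentumLowering (N : ℕ) (T : ℝ) (g : PhaseSpace N → ℝ) (x : PhaseSpace N) : ℝ :=
  ∑ i : Fin N, (-(T * partialQ i (partialP i g) x) + partialQ i (P.hamiltonian N) x * partialP i g x)

/-- The **Liouvillian** (Hamiltonian vector field, generator of the Koopman group)
`L_H f = ∑_i (p_i ∂_{q_i} f - ∂_{q_i} H ∂_{p_i} f)` of the `N`-site chain — the `γ = 0` part of
`OscillatorChain.generator`; Risken's streaming operator `L_rev = -v ∂_x + f' ∂_v` (10.12) is
its negative acting on densities. [cite: Risken1996, §10.1.2 eq. (10.12)] -/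
def liouvillian (N : ℕ) (f : PhaseSpace N → ℝ) (x : PhaseSpace N) : ℝ :=
  ∑ i : Fin N, (x.2 i * partialQ i f x - partialQ i (P.hamiltonian N) x * partialP i f x)

/-- The **floor operator** `S_q f = ∑_i (T ∂²_{q_i} f - ∂_{q_i} H ∂_{q_i} f)`: `T` times the
generator of the reversible overdamped (Smoluchowski) Langevin dynamics of the positions at
temperature `T`, acting on functions of phase space through their position dependence
(Risken's `L_S = γ⁻¹ ∂_x (f' + v_th² ∂_x)` on densities, (10.168)/(10.170), in the observable
picture); `-S_q = R† R` on functions of the positions (`momentumLowering_momentumRaising_comp_fst`).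
[cite: Risken1996, §10.4 eqs. (10.168)–(10.170)] -/
def smoluchowski (N : ℕ) (T : ℝ) (f : PhaseSpace N → ℝ) (x : PhaseSpace N) : ℝ :=
  ∑ i : Fin N, (T * partialQ i (partialQ i f) x - partialQ i (P.hamiltonian N) x * partialQ i f x)

/-- The Liouvillian is the Poisson bracket with the Hamiltonian: `L_H f = {H, f}`
(`∂_{p_i} H = p_i`). [folklore] -/
theorem liouvillian_eq_poisson (N : ℕ) (f : PhaseSpace N → ℝ) (x : PhaseSpace N) :
    P.liouvillian N f x = poisson (P.hamiltonian N) f x := by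
  simp only [liouvillian, poisson, P.partialP_hamiltonian]

/-- The Liouvillian is the bath-free generator: for a chain with `γ = 0`,
`generator = L_H` whatever the bath temperatures. [folklore] -/
theorem generator_eq_liouvillian_of_gamma_eq_zero (hγ : P.γ = 0) (N : ℕ) (T_L T_R : ℝ)
    (f : PhaseSpace N → ℝ) (x : PhaseSpace N) :
    P.generator N T_L T_R f x = P.liouvillian N f x := by
  simp [generator, liouvillian, hγ]

end OscillatorChain

/-- Mixed coordinate derivatives of a `C²` function commute:
`∂_{p_i} ∂_{q_j} f = ∂_{q_j} ∂_{p_i} f` (Schwarz). [folklore] -/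
theorem partialP_partialQ_comm {f : PhaseSpace N → ℝ} (hf : ContDiff ℝ 2 f) (i j : Fin N)
    (x : PhaseSpace N) : partialP i (partialQ j f) x = partialQ j (partialP i f) x := by
  have hfd : Differentiable ℝ f := hf.differentiable two_ne_zero
  have hQ : partialQ j f = fun y => fderiv ℝ f y ((Pi.single j 1, 0) : PhaseSpace N) :=
    partialQ_eq_fderiv hfd j
  have hP : partialP i f = fun y => fderiv ℝ f y ((0, Pi.single i 1) : PhaseSpace N) :=
    partialP_eq_fderiv hfd i
  have hdQ : Differentiable ℝ (partialQ j f) := by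
    rw [hQ]; exact fun y => (hasFDerivAt_fderiv_apply hf y _).differentiableAt
  have hdP : Differentiable ℝ (partialP i f) := by
    rw [hP]; exact fun y => (hasFDerivAt_fderiv_apply hf y _).differentiableAt
  rw [partialP_eq_fderiv hdQ, partialQ_eq_fderiv hdP]
  simp only [hQ, hP]
  rw [(hasFDerivAt_fderiv_apply hf x _).fderiv, (hasFDerivAt_fderiv_apply hf x _).fderiv]
  simp only [ContinuousLinearMap.flip_apply]
  exact fderiv_fderiv_symm hf x _ _

/-- **The ladder identity `L_H = R - R†`** (pointwise, for `f ∈ C²`): the Hamiltonian vector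
field is the raising operator minus the lowering operator — part (a) of route item
`LadderAdjoint`; Risken (10.26)/(10.35): `L̄_rev = -∑_i (b_i D_i + b_i⁺ D̂_i)`. [cite: Risken1996, §10.1.3 eqs. (10.26) and (10.35)] -/
theorem OscillatorChain.liouvillian_eq_momentumRaising_sub_momentumLowering (P : OscillatorChain)
    (T : ℝ) {f : PhaseSpace N → ℝ} (hf : ContDiff ℝ 2 f) (x : PhaseSpace N) :
    P.liouvillian N f x = momentumRaising T f x - P.momentumLowering N T f x := by
  simp only [OscillatorChain.liouvillian, momentumRaising, OscillatorChain.momentumLowering,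
    ← Finset.sum_sub_distrib]
  refine Finset.sum_congr rfl fun i _ => ?_
  rw [partialP_partialQ_comm hf i i x]
  ring

/-- The **elementary function** `G(q) He_α(p)` of the `N`-site chain with position coefficient
`G` and multi-index `α` (momentum-Hermite degree `∑ α i`); a member of
`(ofPhaseSpace N T).elementary (∑ α i)` (`elementaryFun_mem_elementary`). [cite: Risken1996, §10.1.4 eq. (10.50)] -/
def elementaryFun (T : ℝ) (G : (Fin N → ℝ) → ℝ) (α : Fin N → ℕ) : PhaseSpace N → ℝ :=
  fun y => G y.1 * hermiteProd T α y.2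

/-- Unfolding `elementaryFun`. [folklore] -/
theorem elementaryFun_apply (T : ℝ) (G : (Fin N → ℝ) → ℝ) (α : Fin N → ℕ) (y : PhaseSpace N) :
    elementaryFun T G α y = G y.1 * hermiteProd T α y.2 :=
  rfl

/-- `elementaryFun T G α` is elementary of degree `∑ α i` for the `N`-site ladder. [folklore] -/
theorem elementaryFun_mem_elementary (T : ℝ) (G : (Fin N → ℝ) → ℝ) (α : Fin N → ℕ) :
    elementaryFun T G α ∈ (MomentumHermiteLadder.ofPhaseSpace N T).elementary (∑ i, α i) := by
  refine ⟨G, Finsupp.equivFunOnFinite.symm α, ?_, ?_⟩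
  · rw [Finsupp.degree_eq_sum]
    rfl
  · funext y
    rw [MomentumHermiteLadder.hermiteMonomial_ofPhaseSpace]
    rfl

/-- A function of the positions alone is the elementary function with `α = 0`. [folklore] -/
theorem comp_fst_eq_elementaryFun (T : ℝ) (g : (Fin N → ℝ) → ℝ) :
    (g ∘ Prod.fst : PhaseSpace N → ℝ) = elementaryFun T g 0 := by
  funext y
  simp [elementaryFun, hermiteProd]

/-- A function of the positions has vanishing momentum derivatives. [folklore] -/
@[simp] theorem partialP_comp_fst (g : (Fin N → ℝ) → ℝ) (i : Fin N) (x : PhaseSpace N) :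
    partialP i (g ∘ Prod.fst : PhaseSpace N → ℝ) x = 0 := by
  simp [partialP]

/-- `∂_{q_i}` of a function of the positions is the coordinate derivative of `g`. [folklore] -/
theorem partialQ_comp_fst (g : (Fin N → ℝ) → ℝ) (i : Fin N) :
    partialQ i (g ∘ Prod.fst : PhaseSpace N → ℝ) =
      ((fun q => deriv (fun t => g (Function.update q i t)) (q i)) ∘ Prod.fst : PhaseSpace N → ℝ) :=
  rfl

/-- `∂_{p_i} (∑_j p_j c_j(q)) = c_i(q)`. [folklore] -/
theorem partialP_sum_snd_mul (c : Fin N → (Fin N → ℝ) → ℝ) (i : Fin N) (x : PhaseSpace N) :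
    partialP i (fun y : PhaseSpace N => ∑ j, y.2 j * c j y.1) x = c i x.1 := by
  unfold partialP
  have h : ∀ t : ℝ, (∑ j, Function.update x.2 i t j * c j x.1) =
      t * c i x.1 + ∑ j ∈ Finset.univ.erase i, x.2 j * c j x.1 := by
    intro t
    rw [← Finset.add_sum_erase _ _ (Finset.mem_univ i), Function.update_self]
    congr 1
    exact Finset.sum_congr rfl fun j hj => by
      rw [Function.update_of_ne (Finset.ne_of_mem_erase hj)]
  simp_rw [h]
  rw [deriv_add_const, deriv_mul_const_field]
  simp

/-- **`R` on functions of the positions**: `R (g ∘ q) = ∑_i p_i ∂_i g` (the operator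
`B₀ = R|_{𝒫_0}`: positions stream with their momenta). [folklore] -/
theorem momentumRaising_comp_fst (T : ℝ) (g : (Fin N → ℝ) → ℝ) :
    momentumRaising T (g ∘ Prod.fst : PhaseSpace N → ℝ) =
      fun x => ∑ i, x.2 i * deriv (fun t => g (Function.update x.1 i t)) (x.1 i) := by
  funext x
  simp only [momentumRaising]
  refine Finset.sum_congr rfl fun i _ => ?_
  rw [partialQ_comp_fst, partialP_comp_fst]
  simp

/-- **The floor of the ladder: `R† R = -S_q` on functions of the positions** (`B₀* B₀ = -S_q`,
the `n = 0` block; Risken (10.170): eliminating `c_1` from the truncated hierarchy gives the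
Smoluchowski operator `D D̂`). Pointwise and unconditional (both sides use the same coordinate
derivatives). [cite: Risken1996, §10.4 eqs. (10.169)–(10.170)] -/
theorem OscillatorChain.momentumLowering_momentumRaising_comp_fst (P : OscillatorChain) (T : ℝ)
    (g : (Fin N → ℝ) → ℝ) (x : PhaseSpace N) :
    P.momentumLowering N T (momentumRaising T (g ∘ Prod.fst : PhaseSpace N → ℝ)) x =
      -P.smoluchowski N T (g ∘ Prod.fst : PhaseSpace N → ℝ) x := by
  rw [momentumRaising_comp_fst]
  have hP : ∀ i : Fin N, partialP i (fun y : PhaseSpace N =>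
      ∑ j, y.2 j * deriv (fun t => g (Function.update y.1 j t)) (y.1 j)) =
        ((fun q => deriv (fun t => g (Function.update q i t)) (q i)) ∘ Prod.fst :
          PhaseSpace N → ℝ) :=
    fun i => funext fun y =>
      partialP_sum_snd_mul (fun j q => deriv (fun t => g (Function.update q j t)) (q j)) i y
  simp only [OscillatorChain.momentumLowering, OscillatorChain.smoluchowski, hP,
    partialQ_comp_fst g, ← Finset.sum_neg_distrib]
  refine Finset.sum_congr rfl fun i _ => ?_
  simp only [Function.comp_apply]
  ring

/-- **`R` raises the degree**: on an elementary function `G(q) He_α(p)`,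
`R (G He_α) = √T ∑_i (∂_i G) He_{α + e_i}` — a combination of elementary functions of
momentum-Hermite degree `|α| + 1` (Risken (10.45)–(10.46): `b⁺ ψ_n = √(n+1) ψ_{n+1}` couples
`c_n` to `c_{n+1}`). [cite: Risken1996, §10.1.4 eqs. (10.45)–(10.46)] -/
theorem momentumRaising_elementaryFun {T : ℝ} (hT : 0 < T) (G : (Fin N → ℝ) → ℝ)
    (α : Fin N → ℕ) (x : PhaseSpace N) :
    momentumRaising T (elementaryFun T G α) x =
      Real.sqrt T * ∑ i, elementaryFun T (fun q => deriv (fun t => G (Function.update q i t)) (q i))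
        (Function.update α i (α i + 1)) x := by
  simp only [momentumRaising, Finset.mul_sum, elementaryFun_apply]
  refine Finset.sum_congr rfl fun i _ => ?_
  set C : ℝ := ∏ j ∈ Finset.univ.erase i, hermiteFun T (α j) (x.2 j) with hC
  set dG : ℝ := deriv (fun t => G (Function.update x.1 i t)) (x.1 i) with hdG
  -- `∂_{q_i} (G He_α) = ∂_i G · He_α`
  have hQ : partialQ i (elementaryFun T G α) =
      fun y : PhaseSpace N =>
        deriv (fun t => G (Function.update y.1 i t)) (y.1 i) * hermiteProd T α y.2 := by
    funext y
    simp only [partialQ, elementaryFun]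
    exact deriv_mul_const_field _
  -- `∂_{p_i} (∂_i G · He_α) = ∂_i G · He_{α_i}'(p_i) · ∏_{j ≠ i} He_{α_j}(p_j)`
  have hP : partialP i (partialQ i (elementaryFun T G α)) x =
      dG * (deriv (hermiteFun T (α i)) (x.2 i) * C) := by
    rw [hQ]
    simp only [partialP]
    rw [deriv_const_mul_field]
    congr 1
    have : (fun t => hermiteProd T α (Function.update x.2 i t)) =
        fun t => hermiteFun T (α i) t * C := funext fun t => hermiteProd_update_mom T α x.2 i t
    rw [this, deriv_mul_const_field]
  rw [hP, hQ]
  simp only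
  rw [hermiteProd_eq_mul_prod_erase T α x.2 i, hermiteProd_update_index, ← hC]
  have key := sub_temp_mul_deriv_hermiteFun hT (α i) (x.2 i)
  calc x.2 i * (dG * (hermiteFun T (α i) (x.2 i) * C)) -
        T * (dG * (deriv (hermiteFun T (α i)) (x.2 i) * C))
      = dG * C * (x.2 i * hermiteFun T (α i) (x.2 i) - T * deriv (hermiteFun T (α i)) (x.2 i)) := by
        ring
    _ = dG * C * (Real.sqrt T * hermiteFun T (α i + 1) (x.2 i)) := by rw [key]
    _ = Real.sqrt T * (dG * (hermiteFun T (α i + 1) (x.2 i) * C)) := by ring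

/-- **`R†` lowers the degree**: on an elementary function `G(q) He_α(p)`,
`R† (G He_α) = ∑_i (α_i/√T) (-T ∂_i G + ∂_i Φ · G) He_{α - e_i}` (`Φ` the potential energy,
`∂_{q_i} H = ∂_i Φ`) — a combination of elementary functions of momentum-Hermite degree
`|α| - 1` (Risken (10.45)–(10.46): `b ψ_n = √n ψ_{n-1}` couples `c_n` to `c_{n-1}`).
Unconditional; on the sites with `α i = 0` the coefficient vanishes (and the `ℕ`-subtraction
`α i - 1 = 0` is immaterial). [cite: Risken1996, §10.1.4 eqs. (10.45)–(10.46)] -/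
theorem OscillatorChain.momentumLowering_elementaryFun (P : OscillatorChain) (T : ℝ)
    (G : (Fin N → ℝ) → ℝ) (α : Fin N → ℕ) (x : PhaseSpace N) :
    P.momentumLowering N T (elementaryFun T G α) x =
      ∑ i, (α i : ℝ) / Real.sqrt T *
        elementaryFun T (fun q => -(T * deriv (fun t => G (Function.update q i t)) (q i)) +
            deriv (fun t => P.potential N (Function.update q i t)) (q i) * G q)
          (Function.update α i (α i - 1)) x := by
  simp only [OscillatorChain.momentumLowering, elementaryFun_apply]
  refine Finset.sum_congr rfl fun i _ => ?_
  set C : ℝ := ∏ j ∈ Finset.univ.erase i, hermiteFun T (α j) (x.2 j) with hC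
  set dG : ℝ := deriv (fun t => G (Function.update x.1 i t)) (x.1 i) with hdG
  -- `∂_{p_i} (G He_α) = G · He_{α_i}'(p_i) · ∏_{j ≠ i} He_{α_j}(p_j)`
  have hP : partialP i (elementaryFun T G α) =
      fun y : PhaseSpace N => G y.1 * (deriv (hermiteFun T (α i)) (y.2 i) *
        ∏ j ∈ Finset.univ.erase i, hermiteFun T (α j) (y.2 j)) := by
    funext y
    simp only [partialP, elementaryFun]
    rw [deriv_const_mul_field]
    congr 1
    have : (fun t => hermiteProd T α (Function.update y.2 i t)) =
        fun t => hermiteFun T (α i) t * ∏ j ∈ Finset.univ.erase i, hermiteFun T (α j) (y.2 j) :=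
      funext fun t => hermiteProd_update_mom T α y.2 i t
    rw [this, deriv_mul_const_field]
  -- `∂_{q_i} ∂_{p_i} (G He_α) = ∂_i G · He_{α_i}'(p_i) · ∏_{j ≠ i} He_{α_j}(p_j)`
  have hQP : partialQ i (partialP i (elementaryFun T G α)) x =
      dG * (deriv (hermiteFun T (α i)) (x.2 i) * C) := by
    rw [hP]
    simp only [partialQ]
    exact deriv_mul_const_field _
  rw [hQP, hP, P.partialQ_hamiltonian_eq]
  simp only
  rw [← hC]
  cases hα : α i with
  | zero => simp
  | succ m =>
    rw [deriv_hermiteFun_succ, Nat.add_sub_cancel, hermiteProd_update_index, ← hC]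
    push_cast
    ring

/-- **The energy current has momentum-Hermite degree one**: for `T > 0` the bond current
`j_i = -½ (p_i + p_{i+1}) V'(q_{i+1} - q_i)` is a linear combination of the degree-one elementary
functions `V'(q_{i+1} - q_i) · p_i/√T` and `V'(q_{i+1} - q_i) · p_{i+1}/√T` (it is odd under
momentum reversal and linear in the momenta; cf. Risken (10.44a): the probability current is
carried by the coefficient `c_1` alone). [cite: Risken1996, §10.1.4 eq. (10.44a)] -/
theorem OscillatorChain.bondCurrent_mem_span_elementary_one (P : OscillatorChain) {T : ℝ}
    (hT : 0 < T) (i : Fin N) :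
    P.bondCurrent N i ∈
      Submodule.span ℝ ((MomentumHermiteLadder.ofPhaseSpace N T).elementary 1) := by
  have hs : Real.sqrt T ≠ 0 := Real.sqrt_ne_zero'.mpr hT
  have hfun : P.bondCurrent N i = ∑ j : Fin N, fun x : PhaseSpace N =>
      if j.val = i.val + 1 then -((x.2 i + x.2 j) / 2 * deriv P.V (x.1 j - x.1 i)) else 0 := by
    funext x
    simp only [OscillatorChain.bondCurrent, Finset.sum_apply]
  rw [hfun]
  refine Submodule.sum_mem _ fun j _ => ?_
  by_cases hj : j.val = i.val + 1
  · simp only [if_pos hj]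
    have e : (fun x : PhaseSpace N => -((x.2 i + x.2 j) / 2 * deriv P.V (x.1 j - x.1 i))) =
        (-(Real.sqrt T / 2)) •
            (fun x : PhaseSpace N => deriv P.V (x.1 j - x.1 i) * (x.2 i / Real.sqrt T)) +
          (-(Real.sqrt T / 2)) •
            (fun x : PhaseSpace N => deriv P.V (x.1 j - x.1 i) * (x.2 j / Real.sqrt T)) := by
      funext x
      simp only [Pi.add_apply, Pi.smul_apply, smul_eq_mul]
      field_simp
      ring
    rw [e]
    refine Submodule.add_mem _ (Submodule.smul_mem _ _ (Submodule.subset_span ?_))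
      (Submodule.smul_mem _ _ (Submodule.subset_span ?_))
    · exact (MomentumHermiteLadder.ofPhaseSpace N T).mul_mom_div_mem_elementary_one
        (fun q => deriv P.V (q j - q i)) i
    · exact (MomentumHermiteLadder.ofPhaseSpace N T).mul_mom_div_mem_elementary_one
        (fun q => deriv P.V (q j - q i)) j
  · simp only [if_neg hj]
    exact Submodule.zero_mem _

/-- At the `L²` level: if the bond current is square integrable with respect to a state `μ` on
the `N`-site phase space and the two pieces `V'(q_{i+1}-q_i) p_i`, `V'(q_{i+1}-q_i) p_{i+1}` are,
then its class lies in `𝒫_1(μ)` — recorded in the simplest usable form: the class of any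
square-integrable function in the linear span of square-integrable degree-`n` elementary
functions lies in `𝒫_n(μ)`. [folklore] -/
theorem MomentumHermiteLadder.toLp_mem_degreeSubspace_of_eq_add {ι Q Ω : Type*}
    [MeasurableSpace Q] [MeasurableSpace Ω] (L : MomentumHermiteLadder ι Q Ω) {μ : Measure Ω}
    {n : ℕ} {f g h : Ω → ℝ} (a b : ℝ) (hg : g ∈ L.elementary n) (hh : h ∈ L.elementary n)
    (hg2 : MemLp g 2 μ) (hh2 : MemLp h 2 μ) (hf2 : MemLp f 2 μ) (hf : f = a • g + b • h) :
    hf2.toLp f ∈ L.degreeSubspace μ n := by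
  have e : hf2.toLp f = a • hg2.toLp g + b • hh2.toLp h := by
    subst hf
    rw [← MemLp.toLp_const_smul, ← MemLp.toLp_const_smul, ← MemLp.toLp_add]
  rw [e]
  exact Submodule.add_mem _ (Submodule.smul_mem _ _ (L.toLp_mem_degreeSubspace hg hg2))
    (Submodule.smul_mem _ _ (L.toLp_mem_degreeSubspace hh hh2))

end FiniteChain

/-! ## §5. The infinite chain: coordinates on `ChainConfig` and the ladder on cylinder functions -/

section InfiniteChain

/-- The momentum-Hermite ladder structure of the infinite chain at temperature `T`:
position field `x ↦ q_x = (σ x).1`, momenta `p_x = (σ x).2`; to be paired with a DLR Gibbs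
state `μ` (`OscillatorChain.IsChainGibbsMeasure P T μ`). [folklore] -/
def MomentumHermiteLadder.ofChainConfig (T : ℝ) : MomentumHermiteLadder ℤ (ℤ → ℝ) ChainConfig where
  pos σ := fun x => (σ x).1
  mom x σ := (σ x).2
  T := T
  measurable_pos := measurable_pi_lambda _ fun x => (measurable_pi_apply x).fst
  measurable_mom x := (measurable_pi_apply x).snd

/-- The degree-one Hermite monomial of the infinite chain at site `x` is `p_x/√T`. [folklore] -/
theorem MomentumHermiteLadder.hermiteMonomial_ofChainConfig_single (T : ℝ) (x : ℤ)
    (σ : ChainConfig) :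
    (MomentumHermiteLadder.ofChainConfig T).hermiteMonomial (Finsupp.single x 1) σ =
      (σ x).2 / Real.sqrt T := by
  simp [MomentumHermiteLadder.ofChainConfig]

/- The coordinate derivatives `partialQZ x f σ = d/dt f(σ[x ↦ (t, p_x)])|_{t=q_x}` and
`partialPZ x f σ = d/dt f(σ[x ↦ (q_x, t)])|_{t=p_x}` of the infinite chain are the declarations of
`Literature.MathematicalPhysics.KineticTheory.InfiniteChainInvariantStates` (same namespace, byte-identical
bodies; formerly duplicated here, which made this module and `InfiniteChainInvariantStates` mutually
un-importable — `environment already contains 'HeatConduction.partialQZ'`). -/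

/-- A cylinder function (`DependsOn f Λ`) has `∂_{q_x} f = 0` off `Λ`. [folklore] -/
theorem partialQZ_eq_zero_of_dependsOn {f : ChainConfig → ℝ} {Λ : Set ℤ} (hf : DependsOn f Λ)
    {x : ℤ} (hx : x ∉ Λ) (σ : ChainConfig) : partialQZ x f σ = 0 := by
  unfold partialQZ
  have : (fun t : ℝ => f (Function.update σ x (t, (σ x).2))) = fun _ => f σ := by
    funext t
    exact hf fun y hy => Function.update_of_ne (ne_of_mem_of_not_mem hy hx) _ _
  rw [this, deriv_const]

/-- A cylinder function (`DependsOn f Λ`) has `∂_{p_x} f = 0` off `Λ`. [folklore] -/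
theorem partialPZ_eq_zero_of_dependsOn {f : ChainConfig → ℝ} {Λ : Set ℤ} (hf : DependsOn f Λ)
    {x : ℤ} (hx : x ∉ Λ) (σ : ChainConfig) : partialPZ x f σ = 0 := by
  unfold partialPZ
  have : (fun t : ℝ => f (Function.update σ x ((σ x).1, t))) = fun _ => f σ := by
    funext t
    exact hf fun y hy => Function.update_of_ne (ne_of_mem_of_not_mem hy hx) _ _
  rw [this, deriv_const]

/-- The **raising operator of the infinite chain** `R f = ∑_x (p_x ∂_{q_x} f - T ∂_{p_x} ∂_{q_x} f)`
on (smooth cylinder) functions of `ChainConfig`; `finsum`, so the junk value `0` is returned if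
infinitely many terms are non-zero (never the case for cylinder functions,
`momentumRaisingZ_eq_sum`). [cite: Risken1996, §10.1.3 eq. (10.35)] -/
def momentumRaisingZ (T : ℝ) (f : ChainConfig → ℝ) (σ : ChainConfig) : ℝ :=
  ∑ᶠ x : ℤ, ((σ x).2 * partialQZ x f σ - T * partialPZ x (partialQZ x f) σ)

namespace OscillatorChain

variable (P : OscillatorChain)

/-- The **lowering operator of the infinite chain**
`R† g = ∑_x (-T ∂_{q_x} ∂_{p_x} g + ∂_{q_x}H ∂_{p_x} g)` with `∂_{q_x} H = -F_x = U'(q_x) - R_x(q)`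
(`OscillatorChain.force`; the formal Hamiltonian `∑_x (p_x²/2 + U(q_x) + V(q_{x+1} - q_x))` has
well-defined partial derivatives), on cylinder functions (`finsum`). [cite: Risken1996, §10.1.3 eqs. (10.27)–(10.30)] -/
def momentumLoweringZ (T : ℝ) (g : ChainConfig → ℝ) (σ : ChainConfig) : ℝ :=
  ∑ᶠ x : ℤ, (-(T * partialQZ x (partialPZ x g) σ) - P.force σ x * partialPZ x g σ)

/-- The **Liouvillian of the infinite chain** `L_H f = ∑_x (p_x ∂_{q_x} f + F_x ∂_{p_x} f)`
(`F_x = -∂_{q_x} H`, LLL (1a)–(1b)): the formal generator of `f ↦ f ∘ φ_t` for the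
infinite-volume dynamics, on cylinder functions (`finsum`). [cite: LanfordLebowitzLieb1977, §2 eqs. (1a)–(1b)] -/
def liouvillianZ (f : ChainConfig → ℝ) (σ : ChainConfig) : ℝ :=
  ∑ᶠ x : ℤ, ((σ x).2 * partialQZ x f σ + P.force σ x * partialPZ x f σ)

/-- The **floor operator of the infinite chain** `S_q f = ∑_x (T ∂²_{q_x} f + F_x ∂_{q_x} f)`
(`T` times the overdamped Langevin generator of the position field), on cylinder functions.
[cite: Risken1996, §10.4 eqs. (10.168)–(10.170)] -/
def smoluchowskiZ (T : ℝ) (f : ChainConfig → ℝ) (σ : ChainConfig) : ℝ :=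
  ∑ᶠ x : ℤ, (T * partialQZ x (partialQZ x f) σ + P.force σ x * partialQZ x f σ)

/-- For a cylinder function the Liouvillian is a finite sum over its dependence set. [folklore] -/
theorem liouvillianZ_eq_sum {f : ChainConfig → ℝ} {Λ : Finset ℤ} (hf : DependsOn f (Λ : Set ℤ))
    (σ : ChainConfig) :
    P.liouvillianZ f σ = ∑ x ∈ Λ, ((σ x).2 * partialQZ x f σ + P.force σ x * partialPZ x f σ) := by
  unfold liouvillianZ
  refine finsum_eq_sum_of_support_subset _ fun x hx => ?_
  by_contra hxΛ
  apply hx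
  simp [partialQZ_eq_zero_of_dependsOn hf (by simpa using hxΛ),
    partialPZ_eq_zero_of_dependsOn hf (by simpa using hxΛ)]

end OscillatorChain

/-- For a cylinder function the raising operator is a finite sum over its dependence set. [folklore] -/
theorem momentumRaisingZ_eq_sum (T : ℝ) {f : ChainConfig → ℝ} {Λ : Finset ℤ}
    (hf : DependsOn f (Λ : Set ℤ)) (σ : ChainConfig) :
    momentumRaisingZ T f σ =
      ∑ x ∈ Λ, ((σ x).2 * partialQZ x f σ - T * partialPZ x (partialQZ x f) σ) := by
  unfold momentumRaisingZ
  refine finsum_eq_sum_of_support_subset _ fun x hx => ?_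
  by_contra hxΛ
  apply hx
  have h0 : partialQZ x f = fun _ => 0 :=
    funext fun τ => partialQZ_eq_zero_of_dependsOn hf (by simpa using hxΛ) τ
  simp [h0, partialPZ]

/-- **The energy current of the infinite chain has momentum-Hermite degree one** (`T > 0`):
`j_x = -½(p_x + p_{x+1}) V'(q_{x+1} - q_x)` is a linear combination of the degree-one elementary
functions `V'(q_{x+1} - q_x) p_x/√T`, `V'(q_{x+1} - q_x) p_{x+1}/√T`. [cite: Risken1996, §10.1.4 eq. (10.44a)] -/
theorem OscillatorChain.bondCurrentZ_mem_span_elementary_one (P : OscillatorChain) {T : ℝ}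
    (hT : 0 < T) (x : ℤ) :
    (fun σ => P.bondCurrentZ σ x) ∈
      Submodule.span ℝ ((MomentumHermiteLadder.ofChainConfig T).elementary 1) := by
  have hs : Real.sqrt T ≠ 0 := Real.sqrt_ne_zero'.mpr hT
  have e : (fun σ => P.bondCurrentZ σ x) =
      (-(Real.sqrt T / 2)) • (fun σ : ChainConfig =>
          deriv P.V ((σ (x + 1)).1 - (σ x).1) * ((σ x).2 / Real.sqrt T)) +
        (-(Real.sqrt T / 2)) • (fun σ : ChainConfig =>
          deriv P.V ((σ (x + 1)).1 - (σ x).1) * ((σ (x + 1)).2 / Real.sqrt T)) := by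
    funext σ
    simp only [OscillatorChain.bondCurrentZ, Pi.add_apply, Pi.smul_apply, smul_eq_mul]
    field_simp
    ring
  rw [e]
  refine Submodule.add_mem _ (Submodule.smul_mem _ _ (Submodule.subset_span ?_))
    (Submodule.smul_mem _ _ (Submodule.subset_span ?_))
  · exact (MomentumHermiteLadder.ofChainConfig T).mul_mom_div_mem_elementary_one
      (fun q : ℤ → ℝ => deriv P.V (q (x + 1) - q x)) x
  · exact (MomentumHermiteLadder.ofChainConfig T).mul_mom_div_mem_elementary_one
      (fun q : ℤ → ℝ => deriv P.V (q (x + 1) - q x)) (x + 1)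

end InfiniteChain

/-! ## §6. The same grading on the zero-wavenumber (fluctuation) space `ℋ₀(μ)` -/

section ZeroWavenumber

variable {G : Type*} [AddCommGroup G] [MeasurableSpace G] [MeasurableNeg G]
variable {ι Q Ω : Type*} [MeasurableSpace Q] [MeasurableSpace Ω]
variable {ν : Measure G} [ν.IsNegInvariant] {Tsh : ShiftAction G Ω}

namespace MomentumHermiteLadder

variable (L : MomentumHermiteLadder ι Q Ω) (F : FluctuationStructure ν Tsh)

/-- The **degree-`n` subspace of the zero-wavenumber space** `ℋ₀(μ)` (Spohn–Doyon fluctuation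
space `FluctuationStructure.FluctuationSpace`, the pending `ZeroWavenumberSpace` of the chain
being its instance `G = ℤ`): the closed span of the classes `[f]` of the LOCAL elementary
functions `f = G(q) He_α(p)`, `|α| = n`, `f ∈ 𝒱`. With `grading := fluctDegreeSubspace` the
projections `P_n`, the number operator and the parity of §2 are those of `ℋ₀(μ)`; the current
class `[j_0]` lies in degree one (`fluct_mem_fluctDegreeSubspace_of_eq_add` with
`OscillatorChain.bondCurrentZ_mem_span_elementary_one`). [cite: Doyon2022, §4.3] -/
def fluctDegreeSubspace (n : ℕ) : Submodule ℝ F.FluctuationSpace :=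
  (Submodule.span ℝ (F.fluct '' (L.elementary n ∩ (F.localObs : Set (Ω → ℝ))))).topologicalClosure

/-- The momentum-Hermite grading of `ℋ₀(μ)`. [folklore] -/
abbrev fluctGrading : ℕ → Submodule ℝ F.FluctuationSpace := L.fluctDegreeSubspace F

/-- The degree projections of `ℋ₀(μ)`. [folklore] -/
abbrev fluctProj (n : ℕ) : F.FluctuationSpace →L[ℝ] F.FluctuationSpace :=
  degreeProjection (L.fluctGrading F) n

/-- The number operator of `ℋ₀(μ)`. [folklore] -/
abbrev fluctNumber : F.FluctuationSpace →ₗ.[ℝ] F.FluctuationSpace :=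
  numberOperator (L.fluctGrading F)

/-- The momentum-reversal (parity) operator of `ℋ₀(μ)`. [folklore] -/
abbrev fluctParity : F.FluctuationSpace →L[ℝ] F.FluctuationSpace :=
  parityOperator (L.fluctGrading F)

/-- The class of a local elementary function of degree `n` lies in the degree-`n` subspace of
`ℋ₀(μ)`. [folklore] -/
theorem fluct_mem_fluctDegreeSubspace {n : ℕ} {f : Ω → ℝ} (hf : f ∈ L.elementary n)
    (hfV : f ∈ F.localObs) : F.fluct f ∈ L.fluctDegreeSubspace F n :=
  (Submodule.span ℝ _).le_topologicalClosure (Submodule.subset_span ⟨f, ⟨hf, hfV⟩, rfl⟩)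

/-- A linear combination of two local elementary functions of degree `n` has its class in the
degree-`n` subspace of `ℋ₀(μ)` (shape of the current `j_0 = a g + b h`). [folklore] -/
theorem fluct_mem_fluctDegreeSubspace_of_eq_add {n : ℕ} {f g h : Ω → ℝ} (a b : ℝ)
    (hg : g ∈ L.elementary n) (hh : h ∈ L.elementary n) (hgV : g ∈ F.localObs)
    (hhV : h ∈ F.localObs) (hf : f = a • g + b • h) : F.fluct f ∈ L.fluctDegreeSubspace F n := by
  subst hf
  rw [F.fluct_add (F.localObs.smul_mem a hgV) (F.localObs.smul_mem b hhV), F.fluct_smul a hgV,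
    F.fluct_smul b hhV]
  exact Submodule.add_mem _ (Submodule.smul_mem _ _ (L.fluct_mem_fluctDegreeSubspace F hg hgV))
    (Submodule.smul_mem _ _ (L.fluct_mem_fluctDegreeSubspace F hh hhV))

end MomentumHermiteLadder

end ZeroWavenumber

end Literature.MathematicalPhysics.KineticTheory.HeatConduction
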